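/- WIDTH seat `ym-line-cbag-p1-w2` (prover-ym-line-cbag-p1-w2-g23-0), LINE 7b `GlueballBandRecursion` (volume comparison → rung), in
support of ⟨stmt-QuantumFields-22957⟩: the ENCODING-FREE GIRTH CORE of the torus slab lemma (LEAD ym-line-cbag-p1 g29, division of labour
2026-08-28T20:11:33Z, piece C2-core).  Pure finite combinatorics over Mathlib; definition-free; route-independent; a helper. -/
import Mathlib.Data.ZMod.Basic
import Mathlib.Data.Finset.Card
import Mathlib.Algebra.Group.Pi.Lemmas
import Mathlib.Tactic.NormNum
import Mathlib.Tactic.Push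

/-!
# Route `GlueballBandRecursion`, LINE 7b: the girth core of the torus slab lemma

The closedness-aware volume comparison of the strong-coupling free energy (LINE 7b, evidence #9–#11 on stmt-QuantumFields-22957)
rests on one geometric count: a CLOSED family of plaquettes of the four-dimensional periodic box (every bond of every member lies in
another member) that crosses the slab between two consecutive levels of a direction `i` crosses it with at least `min(4, sides)`
plaquettes.  Reading an `i`-crossing plaquette `(x, {i,ν})` as the EDGE `{x̄, x̄ + e_ν}` of the cross-section torus `∏_{j ≠ i} ℤ/n_j`,
closedness says that every vertex touched by the crossing set has degree `≥ 2` in it, and the count is the statement that such an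
edge set contains a cycle, of length `≥ 3` in a simple graph and `≥ 4` in a graph without triangles.  This file proves exactly that
core, free of any plaquette encoding (the encoding half — plaquette ↦ cross-section edge, closedness ⇒ degree `≥ 2` — belongs to the
LEAD's typing of the thermal free-energy system):

* §1 (abstract) `three_le_card_of_two_le_degree`, `four_le_card_of_two_le_degree_of_no_triangle`: a nonempty finite family of
  edges with two-element endpoint sets, injective endpoints and all touched vertices of degree `≥ 2` has `≥ 3` members, and `≥ 4`
  if no three members form a triangle;
* §2 (the discrete torus `Π j, ZMod (n j)` with unit steps `Pi.single a 1`): `pair_step_injective`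
  (sides `≥ 3`: `{x, x+e_a} = {y, y+e_b} → x = y ∧ a = b`, no double edges); `no_unit_triangle` (sides `≥ 4`: three unit steps do
  not close up);
* §3 (torus edge families given by a base point and a direction): `three_le_card_torusEdges` (sides `≥ 3`) and
  `four_le_card_torusEdges` (sides `≥ 4`) — the form in which the slab lemma consumes the core.

The `ℤ^d` (free-boundary) slab lemma of the tree is `Literature…StrongCouplingClustering.four_le_card_filter_level`; the torus needs
the side conditions because `ℤ/2` has double edges and `ℤ/3` has triangles.

HONEST FRAMING.  Finite combinatorics; item 22957, the volume comparison, LINE 7's RECORD rung `ColdDoublingRecursionStrongCoupling`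
and the Yang–Mills mass gap / summit `YangMills` are NOT proved or advanced here.
-/

set_option autoImplicit false

namespace Summit.QuantumFields.YangMills.Theorems.GlueballBandRecursion.SlabGirth

/-! ## §1 The abstract girth core -/

section Abstract

variable {V ι : Type*} [DecidableEq V] [DecidableEq ι]

/-- From a two-element set containing `v`: the other element `w ≠ v` with `s = {v, w}`. -/
theorem exists_pair_eq_of_mem_card_two {s : Finset V} (hs : s.card = 2) {v : V} (hv : v ∈ s) :
    ∃ w, w ≠ v ∧ s = {v, w} := by
  obtain ⟨a, b, hab, rfl⟩ := Finset.card_eq_two.1 hs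
  simp only [Finset.mem_insert, Finset.mem_singleton] at hv
  rcases hv with rfl | rfl
  · exact ⟨b, hab.symm, rfl⟩
  · exact ⟨a, hab, Finset.pair_comm a v⟩

omit [DecidableEq ι] in
/-- **Girth core, simple graphs: at least three edges.**  Let `E` be a nonempty finite family of edges with two-element endpoint
sets `ends e`, injective on `E` (no double edges), such that every endpoint of every member lies in another member (all touched
vertices have degree `≥ 2`).  Then `E` has at least three members. -/
theorem three_le_card_of_two_le_degree {E : Finset ι} {ends : ι → Finset V}
    (hcard : ∀ e ∈ E, (ends e).card = 2)
    (hsimple : ∀ e₁ ∈ E, ∀ e₂ ∈ E, ends e₁ = ends e₂ → e₁ = e₂)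
    (hdeg : ∀ e ∈ E, ∀ v ∈ ends e, ∃ e' ∈ E, e' ≠ e ∧ v ∈ ends e')
    (hne : E.Nonempty) : 3 ≤ E.card := by
  obtain ⟨e₀, he₀⟩ := hne
  obtain ⟨u, v, huv, h0⟩ := Finset.card_eq_two.1 (hcard e₀ he₀)
  obtain ⟨e₁, he₁, hne₁₀, hv₁⟩ := hdeg e₀ he₀ v (by rw [h0]; simp)
  obtain ⟨w, hwv, h1⟩ := exists_pair_eq_of_mem_card_two (hcard e₁ he₁) hv₁
  have hwu : w ≠ u := by
    rintro rfl
    exact hne₁₀ (hsimple e₁ he₁ e₀ he₀ (by rw [h1, h0, Finset.pair_comm]))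
  obtain ⟨e₂, he₂, hne₂₁, hw₂⟩ := hdeg e₁ he₁ w (by rw [h1]; simp)
  have hne₂₀ : e₂ ≠ e₀ := by
    rintro rfl
    rw [h0] at hw₂
    simp only [Finset.mem_insert, Finset.mem_singleton] at hw₂
    rcases hw₂ with rfl | rfl
    · exact hwu rfl
    · exact hwv rfl
  have h2 : 2 < E.card :=
    Finset.two_lt_card_iff.2 ⟨e₀, e₁, e₂, he₀, he₁, he₂, hne₁₀.symm, hne₂₀.symm, hne₂₁.symm⟩
  omega

/-- **Girth core, triangle-free graphs: at least four edges.**  As `three_le_card_of_two_le_degree`, assuming moreover that no three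
members of `E` form a triangle `{u,v}, {v,w}, {w,u}`.  Then `E` has at least four members. -/
theorem four_le_card_of_two_le_degree_of_no_triangle {E : Finset ι} {ends : ι → Finset V}
    (hcard : ∀ e ∈ E, (ends e).card = 2)
    (hsimple : ∀ e₁ ∈ E, ∀ e₂ ∈ E, ends e₁ = ends e₂ → e₁ = e₂)
    (hdeg : ∀ e ∈ E, ∀ v ∈ ends e, ∃ e' ∈ E, e' ≠ e ∧ v ∈ ends e')
    (htri : ∀ e₁ ∈ E, ∀ e₂ ∈ E, ∀ e₃ ∈ E, ∀ u v w : V,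
      ends e₁ = {u, v} → ends e₂ = {v, w} → ends e₃ = {w, u} → False)
    (hne : E.Nonempty) : 4 ≤ E.card := by
  obtain ⟨e₀, he₀⟩ := hne
  obtain ⟨u, v, huv, h0⟩ := Finset.card_eq_two.1 (hcard e₀ he₀)
  obtain ⟨e₁, he₁, hne₁₀, hv₁⟩ := hdeg e₀ he₀ v (by rw [h0]; simp)
  obtain ⟨w, hwv, h1⟩ := exists_pair_eq_of_mem_card_two (hcard e₁ he₁) hv₁
  have hwu : w ≠ u := by
    rintro rfl
    exact hne₁₀ (hsimple e₁ he₁ e₀ he₀ (by rw [h1, h0, Finset.pair_comm]))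
  obtain ⟨e₂, he₂, hne₂₁, hw₂⟩ := hdeg e₁ he₁ w (by rw [h1]; simp)
  have hne₂₀ : e₂ ≠ e₀ := by
    rintro rfl
    rw [h0] at hw₂
    simp only [Finset.mem_insert, Finset.mem_singleton] at hw₂
    rcases hw₂ with rfl | rfl
    · exact hwu rfl
    · exact hwv rfl
  obtain ⟨y, hyw, h2⟩ := exists_pair_eq_of_mem_card_two (hcard e₂ he₂) hw₂
  have hyv : y ≠ v := by
    rintro rfl
    exact hne₂₁ (hsimple e₂ he₂ e₁ he₁ (by rw [h2, h1, Finset.pair_comm]))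
  have hyu : y ≠ u := by
    rintro rfl
    exact htri e₀ he₀ e₁ he₁ e₂ he₂ y v w h0 h1 h2
  obtain ⟨e₃, he₃, hne₃₂, hy₃⟩ := hdeg e₂ he₂ y (by rw [h2]; simp)
  have hne₃₀ : e₃ ≠ e₀ := by
    rintro rfl
    rw [h0] at hy₃
    simp only [Finset.mem_insert, Finset.mem_singleton] at hy₃
    rcases hy₃ with rfl | rfl
    · exact hyu rfl
    · exact hyv rfl
  have hne₃₁ : e₃ ≠ e₁ := by
    rintro rfl
    rw [h1] at hy₃
    simp only [Finset.mem_insert, Finset.mem_singleton] at hy₃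
    rcases hy₃ with rfl | rfl
    · exact hyv rfl
    · exact hyw rfl
  -- `e₁, e₂, e₃` are three distinct members of `E.erase e₀`
  have h3 : 2 < (E.erase e₀).card :=
    Finset.two_lt_card_iff.2 ⟨e₁, e₂, e₃, Finset.mem_erase.2 ⟨hne₁₀, he₁⟩, Finset.mem_erase.2 ⟨hne₂₀, he₂⟩,
      Finset.mem_erase.2 ⟨hne₃₀, he₃⟩, hne₂₁.symm, hne₃₁.symm, hne₃₂.symm⟩
  rw [Finset.card_erase_of_mem he₀] at h3
  omega

end Abstract

/-! ## §2 The discrete torus `Π j, ℤ/n_j`: no double edges for sides `≥ 3`, no triangles for sides `≥ 4` -/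

section Torus

variable {k : ℕ} {n : Fin k → ℕ}

/-- A nonzero integer of absolute value `< m` is nonzero in `ZMod m` (private: the tree has many copies of this triviality,
e.g. `K0AveragedSingleBondFloor.intCast_ne_zero_of_natAbs_lt`, in modules too heavy to import here). -/
private theorem intCast_ne_zero_of_natAbs_lt {m : ℕ} {s : ℤ} (hs : s ≠ 0) (hlt : s.natAbs < m) :
    ((s : ℤ) : ZMod m) ≠ 0 := by
  haveI : NeZero m := ⟨by omega⟩
  rw [Ne, ZMod.intCast_zmod_eq_zero_iff_dvd, Int.natCast_dvd]
  intro hd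
  have := Nat.le_of_dvd (Int.natAbs_pos.2 hs) hd
  omega

/-- `1 ≠ 0` in `ZMod m` for `2 ≤ m` (private, same reason). -/
private theorem one_ne_zero_of_two_le {m : ℕ} (hm : 2 ≤ m) : (1 : ZMod m) ≠ 0 := by
  have h := intCast_ne_zero_of_natAbs_lt (m := m) (s := 1) one_ne_zero (by omega)
  simpa using h

/-- A unit step moves: `x + e_a ≠ x` when `2 ≤ n a`. -/
theorem add_single_one_ne_self (ha : ∀ j, 2 ≤ n j) (x : (j : Fin k) → ZMod (n j)) (a : Fin k) :
    x + Pi.single a 1 ≠ x := by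
  intro h
  have h' := congrFun h a
  simp only [Pi.add_apply, Pi.single_eq_same, add_eq_left] at h'
  exact one_ne_zero_of_two_le (ha a) h'

/-- Equal unit steps have equal directions (`2 ≤` sides). -/
theorem eq_of_single_one_eq_single_one (ha : ∀ j, 2 ≤ n j) {a b : Fin k}
    (h : (Pi.single a 1 : (j : Fin k) → ZMod (n j)) = Pi.single b 1) : a = b := by
  by_contra hab
  have h' := congrFun h a
  rw [Pi.single_eq_same, Pi.single_eq_of_ne hab] at h'
  exact one_ne_zero_of_two_le (ha a) h'

/-- Two unit steps do not cancel (`3 ≤` sides): `e_a + e_b ≠ 0`. -/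
theorem single_one_add_single_one_ne_zero (hn : ∀ j, 3 ≤ n j) (a b : Fin k) :
    (Pi.single a 1 : (j : Fin k) → ZMod (n j)) + Pi.single b 1 ≠ 0 := by
  intro h
  have h' := congrFun h a
  simp only [Pi.add_apply, Pi.single_eq_same, Pi.zero_apply] at h'
  by_cases hab : b = a
  · subst hab
    rw [Pi.single_eq_same] at h'
    have h2 := intCast_ne_zero_of_natAbs_lt (m := n b) (s := 2) (by omega) (by have := hn b; omega)
    have h'' : (2 : ZMod (n b)) = 0 := by rw [← one_add_one_eq_two]; exact h'
    exact h2 (by exact_mod_cast h'')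
  · simp only [Pi.single_eq_of_ne (Ne.symm hab), add_zero] at h'
    exact one_ne_zero_of_two_le (by have := hn a; omega) h'

/-- **No double edges in the torus** (sides `≥ 3`): the endpoint pair `{x, x + e_a}` determines `x` and `a`. -/
theorem pair_step_injective (hn : ∀ j, 3 ≤ n j) {x y : (j : Fin k) → ZMod (n j)} {a b : Fin k}
    (h : ({x, x + Pi.single a 1} : Finset ((j : Fin k) → ZMod (n j))) = {y, y + Pi.single b 1}) :
    x = y ∧ a = b := by
  have h2 : ∀ j, 2 ≤ n j := fun j => by have := hn j; omega
  have hx : x ∈ ({y, y + Pi.single b 1} : Finset _) := by rw [← h]; simp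
  have hxa : x + Pi.single a 1 ∈ ({y, y + Pi.single b 1} : Finset _) := by rw [← h]; simp
  have hy : y ∈ ({x, x + Pi.single a 1} : Finset _) := by rw [h]; simp
  simp only [Finset.mem_insert, Finset.mem_singleton] at hx hxa hy
  rcases hx with hxy | hxy
  · -- `x = y`: then `x + e_a = y + e_b`
    subst hxy
    refine ⟨rfl, ?_⟩
    rcases hxa with h1 | h1
    · exact absurd h1 (add_single_one_ne_self h2 x a)
    · exact eq_of_single_one_eq_single_one h2 (add_left_cancel h1)
  · -- `x = y + e_b`: then `y = x + e_a` and the two steps cancel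
    exfalso
    rcases hy with h1 | h1
    · rw [h1] at hxy
      exact add_single_one_ne_self h2 x b hxy.symm
    · rw [h1, add_assoc] at hxy
      have : (Pi.single a 1 : (j : Fin k) → ZMod (n j)) + Pi.single b 1 = 0 := by
        have hxy' := hxy.symm
        rwa [add_eq_left] at hxy'
      exact single_one_add_single_one_ne_zero hn a b this

/-- Unordered unit adjacency in signed form: `v = u ± e_a` as `v = u + s•e_a`, `s = ±1`. -/
theorem exists_signed_step {u v : (j : Fin k) → ZMod (n j)}
    (h : ∃ a : Fin k, v = u + Pi.single a 1 ∨ u = v + Pi.single a 1) :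
    ∃ a : Fin k, ∃ s : ℤ, (s = 1 ∨ s = -1) ∧ v = u + Pi.single a ((s : ℤ) : ZMod (n a)) := by
  obtain ⟨a, h | h⟩ := h
  · exact ⟨a, 1, Or.inl rfl, by simpa using h⟩
  · refine ⟨a, -1, Or.inr rfl, ?_⟩
    rw [h, Int.cast_neg, Int.cast_one, Pi.single_neg, add_neg_cancel_right]

/-- **No triangles in the torus** (sides `≥ 4`): three unit steps `±e_a ± e_b ± e_c` never sum to zero, so three sites of
`Π j, ℤ/n_j` are never pairwise unit-adjacent in a cycle `u ∼ v ∼ w ∼ u`. -/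
theorem no_unit_triangle (hn : ∀ j, 4 ≤ n j) {u v w : (j : Fin k) → ZMod (n j)}
    (huv : ∃ a : Fin k, v = u + Pi.single a 1 ∨ u = v + Pi.single a 1)
    (hvw : ∃ b : Fin k, w = v + Pi.single b 1 ∨ v = w + Pi.single b 1)
    (hwu : ∃ c : Fin k, u = w + Pi.single c 1 ∨ w = u + Pi.single c 1) : False := by
  obtain ⟨a, s₁, hs₁, h₁⟩ := exists_signed_step huv
  obtain ⟨b, s₂, hs₂, h₂⟩ := exists_signed_step hvw
  obtain ⟨c, s₃, hs₃, h₃⟩ := exists_signed_step hwu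
  -- the three steps sum to zero
  have hsum : (Pi.single a ((s₁ : ℤ) : ZMod (n a)) : (j : Fin k) → ZMod (n j)) +
      Pi.single b ((s₂ : ℤ) : ZMod (n b)) + Pi.single c ((s₃ : ℤ) : ZMod (n c)) = 0 := by
    have h : u = u + (Pi.single a ((s₁ : ℤ) : ZMod (n a)) + Pi.single b ((s₂ : ℤ) : ZMod (n b)) +
        Pi.single c ((s₃ : ℤ) : ZMod (n c))) := by
      conv_lhs => rw [h₃, h₂, h₁]
      simp only [add_assoc]
    have h' := h.symm
    rwa [add_eq_left] at h'
  -- a single signed unit step is nonzero in every `ZMod (n j)`, `n j ≥ 2`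
  have hunit : ∀ (j : Fin k) (s : ℤ), (s = 1 ∨ s = -1) → ((s : ℤ) : ZMod (n j)) ≠ 0 := by
    intro j s hs
    have := hn j
    exact intCast_ne_zero_of_natAbs_lt (by rcases hs with rfl | rfl <;> omega) (by rcases hs with rfl | rfl <;> omega)
  by_cases hab : b = a
  · subst hab
    by_cases hcb : c = b
    · subst hcb
      -- all three in the same direction: `s₁ + s₂ + s₃ ∈ {±1, ±3}` vanishes in `ZMod (n c)`, `n c ≥ 4`
      have h' := congrFun hsum c
      simp only [Pi.add_apply, Pi.single_eq_same, Pi.zero_apply] at h'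
      have hval : ((s₁ + s₂ + s₃ : ℤ) : ZMod (n c)) = 0 := by push_cast; exact h'
      have := hn c
      refine intCast_ne_zero_of_natAbs_lt ?_ ?_ hval
      · rcases hs₁ with rfl | rfl <;> rcases hs₂ with rfl | rfl <;> rcases hs₃ with rfl | rfl <;> omega
      · rcases hs₁ with rfl | rfl <;> rcases hs₂ with rfl | rfl <;> rcases hs₃ with rfl | rfl <;> omega
    · -- `c` appears once
      have h' := congrFun hsum c
      simp only [Pi.add_apply, Pi.single_eq_same, Pi.zero_apply, Pi.single_eq_of_ne hcb, zero_add] at h'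
      exact hunit c s₃ hs₃ h'
  · by_cases hca : c = a
    · subst hca
      -- `b` appears once
      have h' := congrFun hsum b
      simp only [Pi.add_apply, Pi.single_eq_same, Pi.zero_apply, Pi.single_eq_of_ne hab, zero_add, add_zero] at h'
      exact hunit b s₂ hs₂ h'
    · -- `a` appears once
      have h' := congrFun hsum a
      simp only [Pi.add_apply, Pi.single_eq_same, Pi.zero_apply, Pi.single_eq_of_ne (Ne.symm hab),
        Pi.single_eq_of_ne (Ne.symm hca), add_zero] at h'
      exact hunit a s₁ hs₁ h'

end Torus

/-! ## §3 Edge families of the torus given by a base point and a direction -/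

section TorusEdges

variable {k : ℕ} {n : Fin k → ℕ} {ι : Type*} [DecidableEq ι]

omit [DecidableEq ι] in
/-- **Slab girth, sides `≥ 3`: at least three edges.**  Let `E` be a nonempty finite family of labels, each carrying a base point
`base e` of the torus `Π j, ℤ/n_j` and a direction `dir e`, read as the edge `{base e, base e + e_{dir e}}`; assume `(base, dir)` is
injective on `E` and every endpoint of every member is an endpoint of another member.  If all sides are `≥ 3`, then `3 ≤ #E`. -/
theorem three_le_card_torusEdges (hn : ∀ j, 3 ≤ n j) {E : Finset ι}
    (base : ι → ((j : Fin k) → ZMod (n j))) (dir : ι → Fin k)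
    (hinj : ∀ e₁ ∈ E, ∀ e₂ ∈ E, base e₁ = base e₂ → dir e₁ = dir e₂ → e₁ = e₂)
    (hdeg : ∀ e ∈ E, ∀ v ∈ ({base e, base e + Pi.single (dir e) 1} : Finset ((j : Fin k) → ZMod (n j))),
      ∃ e' ∈ E, e' ≠ e ∧ v ∈ ({base e', base e' + Pi.single (dir e') 1} : Finset ((j : Fin k) → ZMod (n j))))
    (hne : E.Nonempty) : 3 ≤ E.card := by
  classical
  have h2 : ∀ j, 2 ≤ n j := fun j => by have := hn j; omega
  refine three_le_card_of_two_le_degree (ends := fun e => ({base e, base e + Pi.single (dir e) 1} : Finset _))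
    (fun e _ => Finset.card_pair (add_single_one_ne_self h2 (base e) (dir e)).symm) (fun e₁ h₁ e₂ h₂ h => ?_) hdeg hne
  obtain ⟨hb, hd⟩ := pair_step_injective hn h
  exact hinj e₁ h₁ e₂ h₂ hb hd

/-- **Slab girth, sides `≥ 4`: at least four edges.**  As `three_le_card_torusEdges` with all sides `≥ 4`: the torus then has no
triangles (`no_unit_triangle`), so the edge family has at least four members — «at least four plaquettes in every crossed slab». -/
theorem four_le_card_torusEdges (hn : ∀ j, 4 ≤ n j) {E : Finset ι}
    (base : ι → ((j : Fin k) → ZMod (n j))) (dir : ι → Fin k)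
    (hinj : ∀ e₁ ∈ E, ∀ e₂ ∈ E, base e₁ = base e₂ → dir e₁ = dir e₂ → e₁ = e₂)
    (hdeg : ∀ e ∈ E, ∀ v ∈ ({base e, base e + Pi.single (dir e) 1} : Finset ((j : Fin k) → ZMod (n j))),
      ∃ e' ∈ E, e' ≠ e ∧ v ∈ ({base e', base e' + Pi.single (dir e') 1} : Finset ((j : Fin k) → ZMod (n j))))
    (hne : E.Nonempty) : 4 ≤ E.card := by
  classical
  have h3 : ∀ j, 3 ≤ n j := fun j => by have := hn j; omega
  have h2 : ∀ j, 2 ≤ n j := fun j => by have := hn j; omega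
  refine four_le_card_of_two_le_degree_of_no_triangle
    (ends := fun e => ({base e, base e + Pi.single (dir e) 1} : Finset _))
    (fun e _ => Finset.card_pair (add_single_one_ne_self h2 (base e) (dir e)).symm) (fun e₁ h₁ e₂ h₂ h => ?_) hdeg
    (fun e₁ _ e₂ _ e₃ _ u v w hu hv hw => ?_) hne
  · obtain ⟨hb, hd⟩ := pair_step_injective h3 h
    exact hinj e₁ h₁ e₂ h₂ hb hd
  · -- an edge `{base e, base e + e_{dir e}} = {p, q}` makes `p, q` unit-adjacent
    have adj : ∀ (e : ι) (p q : (j : Fin k) → ZMod (n j)),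
        ({base e, base e + Pi.single (dir e) 1} : Finset _) = {p, q} →
          ∃ a : Fin k, q = p + Pi.single a 1 ∨ p = q + Pi.single a 1 := by
      intro e p q he
      have hp : p ∈ ({base e, base e + Pi.single (dir e) 1} : Finset _) := by rw [he]; simp
      have hq : q ∈ ({base e, base e + Pi.single (dir e) 1} : Finset _) := by rw [he]; simp
      have hpq : p ≠ q := by
        intro hpq
        have hc : ({p, q} : Finset _).card = 2 := by
          rw [← he]; exact Finset.card_pair (add_single_one_ne_self h2 (base e) (dir e)).symm
        rw [hpq, Finset.pair_eq_singleton, Finset.card_singleton] at hc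
        omega
      simp only [Finset.mem_insert, Finset.mem_singleton] at hp hq
      rcases hp with rfl | rfl <;> rcases hq with hq | hq
      · exact absurd hq.symm hpq
      · exact ⟨dir e, Or.inl hq⟩
      · exact ⟨dir e, Or.inr (by rw [hq])⟩
      · exact absurd hq.symm hpq
    exact no_unit_triangle hn (adj e₁ u v hu) (adj e₂ v w hv) (adj e₃ w u hw)

end TorusEdges

end Summit.QuantumFields.YangMills.Theorems.GlueballBandRecursion.SlabGirth
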